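import Mathlib
import HarnessLib
import Literature.Barriers.RiemannHypothesis.TuranPartialSums
import Summits.RiemannHypothesis.RiemannHypothesis.Theorems.NbSectionTwoDyadicPairing
import Summits.RiemannHypothesis.RiemannHypothesis.Theorems.NbSectionTwoDyadicStepForm

/-!
# RiemannHypothesis / NbSectionTwoDyadic — EXPANSION, WEAK DUALITY and ATTAINMENT for the
2-section distance (route-independent part of the Assembly)

Support for the Assembly of route `NbSectionTwoDyadic` (item stmt-RiemannHypothesis-22784); this
module imports NO `Theses` file (the closer `Assembly_proof` lives in
`Theorems/NbSectionTwoDyadicAssembly.lean`).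

1. EXPANSION (`sectionTwo_integral_eq`): for `A(s) = Σ_{n<N} a_n (n+1)^{-s}`,
   `∫ |1 − ζ_2 A|²(1/2+it) dt/(1/4+t²) = 2π · V(a)`,
   `V(a) = Σ_{1 ≤ k < 2N} |C_k|²/(k(k+1)) + |C_{2N}|²/(2N)`, `C_k = 1 − Σ_n a_n min(2, ⌊k/(n+1)⌋)`
   (Gram pairing `2π/max(m,n)` from `NbSectionTwoDyadicPairing` + Abel step from
   `NbSectionTwoDyadicStepForm`); integrability (`sectionTwo_integrable`).
2. WEAK DUALITY (`stepForm_lower_bound`, generic): a real certificate `(r, r_tail)` orthogonal to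
   every generator with `⟨1,r⟩ = ‖r‖² = v` gives `V(a) = v + Σ W |C − r|²` for EVERY complex `a`.
3. ATTAINMENT (`stepForm_attained`, generic): a dyadic vector whose partial sums are the
   certificate has `V = ‖r‖²`.

RH-free; exact law of a toy (the 2-section), 0 summit credit. No summit is proved by this file;
nothing here bears on the truth of RH.
-/

noncomputable section

-- D-0017: `Summit.<S>.<S>.…` is the designed namespace of a single-problem summit.
set_option linter.dupNamespace false

open scoped Real ComplexConjugate
open MeasureTheory Complex Filter Finset
open Literature.Barriers.RiemannHypothesis (zetaPartialSum)

namespace Summit.RiemannHypothesis.RiemannHypothesis.Theorems.NbSectionTwo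

/-! ## 1. Expansion -/

/-- The integrand of the 2-section distance as the Gram integrand of a Dirichlet polynomial of
length `2N`. -/
theorem sectionTwo_integrand_eq (N : ℕ) (hN : 1 ≤ N) (a : Fin N → ℂ) (t : ℝ) :
    ‖1 - zetaPartialSum 2 (1 / 2 + t * I) * ∑ n : Fin N, a n * ((n : ℂ) + 1) ^ (-(1 / 2 + t * I))‖ ^ 2
        / (1 / 4 + t ^ 2)
      = ‖∑ m ∈ Icc 1 (2 * N), ((if m = 1 then (1 : ℂ) else 0) -
          ∑ n : Fin N, a n * ((if m = (n : ℕ) + 1 then (1 : ℂ) else 0) +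
            (if m = 2 * ((n : ℕ) + 1) then (1 : ℂ) else 0))) * (m : ℂ) ^ (-(1 / 2 + t * I))‖ ^ 2
        / (1 / 4 + t ^ 2) := by
  have hz : zetaPartialSum 2 (1 / 2 + t * I) = 1 + (2 : ℂ) ^ (-(1 / 2 + t * I)) := by
    unfold zetaPartialSum
    rw [Finset.sum_Icc_succ_top (by norm_num), Finset.Icc_self, Finset.sum_singleton]
    norm_num
  rw [sectionTwoCoeff_sum_cpow N hN a, hz]

/-- **Expansion**: the 2-section distance of the mollifier `A(s) = Σ_{n<N} a_n (n+1)^{-s}` in the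
step-function form, `∫ |1 − ζ_2 A|² dt/(1/4+t²) = 2π (Σ_{k<2N} |C_k|²/(k(k+1)) + |C_{2N}|²/(2N))`
with `C_k = 1 − Σ_n a_n min(2, ⌊k/(n+1)⌋)`. [folklore] -/
theorem sectionTwo_integral_eq (N : ℕ) (hN : 1 ≤ N) (a : Fin N → ℂ) :
    ∫ t : ℝ, ‖1 - zetaPartialSum 2 (1 / 2 + t * I) *
        ∑ n : Fin N, a n * ((n : ℂ) + 1) ^ (-(1 / 2 + t * I))‖ ^ 2 / (1 / 4 + t ^ 2)
      = 2 * π * (∑ k ∈ Ico (1 : ℕ) (2 * N),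
          ‖1 - ∑ n : Fin N, a n * ((min 2 (k / ((n : ℕ) + 1)) : ℕ) : ℂ)‖ ^ 2 / ((k : ℝ) * (k + 1))
        + ‖1 - ∑ n : Fin N, a n * ((min 2 (2 * N / ((n : ℕ) + 1)) : ℕ) : ℂ)‖ ^ 2 / ((2 * N : ℕ) : ℝ)) := by
  simp_rw [sectionTwo_integrand_eq N hN a]
  rw [integral_norm_sq_sum_cpow_div _ (fun m hm => by rw [Finset.mem_Icc] at hm; omega)]
  -- pull out 2π and apply the Abel step
  have hpull : ∀ (x : ℕ → ℕ → ℝ), ∑ m ∈ Icc 1 (2 * N), ∑ n ∈ Icc 1 (2 * N),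
      x m n * (2 * π / ((max m n : ℕ) : ℝ))
      = 2 * π * ∑ m ∈ Icc 1 (2 * N), ∑ n ∈ Icc 1 (2 * N), x m n / ((max m n : ℕ) : ℝ) := by
    intro x
    rw [Finset.mul_sum]
    refine Finset.sum_congr rfl fun m _ => ?_
    rw [Finset.mul_sum]
    refine Finset.sum_congr rfl fun n _ => ?_
    ring
  rw [hpull, sum_sum_div_max_eq]
  congr 1
  have hpart : ∀ k : ℕ, 1 ≤ k →
      ∑ m ∈ Icc 1 k, ∑ n ∈ Icc 1 k, (((if m = 1 then (1 : ℂ) else 0) -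
          ∑ n : Fin N, a n * ((if m = (n : ℕ) + 1 then (1 : ℂ) else 0) +
            (if m = 2 * ((n : ℕ) + 1) then (1 : ℂ) else 0))) *
        conj ((if n = 1 then (1 : ℂ) else 0) -
          ∑ n' : Fin N, a n' * ((if n = (n' : ℕ) + 1 then (1 : ℂ) else 0) +
            (if n = 2 * ((n' : ℕ) + 1) then (1 : ℂ) else 0)))).re
      = ‖1 - ∑ n : Fin N, a n * ((min 2 (k / ((n : ℕ) + 1)) : ℕ) : ℂ)‖ ^ 2 := by
    intro k hk
    rw [← norm_sq_sum_eq_sum_sum_re, sectionTwoCoeff_partial_sum N a k hk]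
  congr 1
  · refine Finset.sum_congr rfl fun k hk => ?_
    rw [Finset.mem_Ico] at hk
    rw [hpart k hk.1]
  · rw [hpart (2 * N) (by omega)]

/-- The integrand of the 2-section distance is integrable against `dt`. [folklore] -/
theorem sectionTwo_integrable (N : ℕ) (hN : 1 ≤ N) (a : Fin N → ℂ) :
    Integrable fun t : ℝ => ‖1 - zetaPartialSum 2 (1 / 2 + t * I) *
        ∑ n : Fin N, a n * ((n : ℂ) + 1) ^ (-(1 / 2 + t * I))‖ ^ 2 / (1 / 4 + t ^ 2) := by
  simp_rw [sectionTwo_integrand_eq N hN a]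
  exact integrable_norm_sq_sum_cpow_div _ (fun m hm => by rw [Finset.mem_Icc] at hm; omega) _

/-! ## 2. Weak duality -/

/-- Real part of a partial sum `C_k = 1 − Σ_n a_n g_n`. -/
theorem re_one_sub_sum_mul_natCast (N : ℕ) (a : Fin N → ℂ) (g : Fin N → ℕ) :
    (1 - ∑ n : Fin N, a n * ((g n : ℕ) : ℂ)).re = 1 - ∑ n : Fin N, (a n).re * (g n : ℝ) := by
  rw [Complex.sub_re, Complex.one_re, Complex.re_sum]
  congr 1
  refine Finset.sum_congr rfl fun n _ => ?_
  simp [Complex.mul_re]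

/-- Extending an orthogonality relation from `k ≥ j` down to `k ≥ 1`: the generator pattern
`min(2, ⌊k/j⌋)` vanishes for `k < j`. -/
theorem sum_Ico_one_eq_sum_Ico (j L : ℕ) (hj : 1 ≤ j) (hjL : j ≤ L) (f : ℕ → ℝ) :
    ∑ k ∈ Ico (1 : ℕ) L, f k * ((min 2 (k / j) : ℕ) : ℝ)
      = ∑ k ∈ Ico j L, f k * ((min 2 (k / j) : ℕ) : ℝ) := by
  rw [← Finset.sum_Ico_consecutive _ hj hjL]
  have h0 : ∑ k ∈ Ico 1 j, f k * ((min 2 (k / j) : ℕ) : ℝ) = 0 := by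
    refine Finset.sum_eq_zero fun k hk => ?_
    rw [Finset.mem_Ico] at hk
    rw [Nat.div_eq_of_lt hk.2]
    simp
  rw [h0, zero_add]

/-- **Weak duality** for the step form `V(a) = Σ_{k<L} |C_k|²/(k(k+1)) + |C_L|²/L` (`L = 2N`,
`C_k = 1 − Σ_n a_n min(2, ⌊k/(n+1)⌋)`): a real certificate `(r, r_tail)` orthogonal to every
generator, with `⟨1,r⟩ = ‖r‖² = v`, gives `V(a) = v + Σ W |C − r|²` — in particular `v ≤ V(a)`
for EVERY complex mollifier `a`. [folklore] -/
theorem stepForm_lower_bound (N L : ℕ) (hL : L = 2 * N) (r : ℕ → ℝ) (rt v : ℝ)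
    (horth : ∀ j : ℕ, 1 ≤ j → j ≤ N → (∑ k ∈ Finset.Ico j L,
      1 / ((k : ℝ) * (k + 1)) * r k * ((min 2 (k / j) : ℕ) : ℝ)) + rt * 2 / (L : ℝ) = 0)
    (hinner : (∑ k ∈ Finset.Ico (1 : ℕ) L, 1 / ((k : ℝ) * (k + 1)) * r k) + rt / (L : ℝ) = v)
    (hnorm : (∑ k ∈ Finset.Ico (1 : ℕ) L, 1 / ((k : ℝ) * (k + 1)) * r k ^ 2) + rt ^ 2 / (L : ℝ) = v)
    (a : Fin N → ℂ) :
    (∑ k ∈ Ico (1 : ℕ) L,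
        ‖1 - ∑ n : Fin N, a n * ((min 2 (k / ((n : ℕ) + 1)) : ℕ) : ℂ)‖ ^ 2 / ((k : ℝ) * (k + 1)))
      + ‖1 - ∑ n : Fin N, a n * ((min 2 (L / ((n : ℕ) + 1)) : ℕ) : ℂ)‖ ^ 2 / (L : ℝ)
    = v + ((∑ k ∈ Ico (1 : ℕ) L, 1 / ((k : ℝ) * (k + 1)) *
        ‖(1 - ∑ n : Fin N, a n * ((min 2 (k / ((n : ℕ) + 1)) : ℕ) : ℂ)) - ((r k : ℝ) : ℂ)‖ ^ 2)
      + 1 / (L : ℝ) *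
        ‖(1 - ∑ n : Fin N, a n * ((min 2 (L / ((n : ℕ) + 1)) : ℕ) : ℂ)) - ((rt : ℝ) : ℂ)‖ ^ 2) := by
  -- the weak-duality identity on the blocks and on the tail
  have hblocks := weakDuality_identity (Ico (1 : ℕ) L) (fun k => 1 / ((k : ℝ) * (k + 1))) r
    (fun k => 1 - ∑ n : Fin N, a n * ((min 2 (k / ((n : ℕ) + 1)) : ℕ) : ℂ))
  have htail := weakDuality_identity ({L} : Finset ℕ) (fun _ => 1 / (L : ℝ)) (fun _ => rt)
    (fun k => 1 - ∑ n : Fin N, a n * ((min 2 (k / ((n : ℕ) + 1)) : ℕ) : ℂ))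
  simp only [Finset.sum_singleton] at htail
  beta_reduce at hblocks htail
  -- real parts of the partial sums
  have hre : ∀ k : ℕ, (1 - ∑ n : Fin N, a n * ((min 2 (k / ((n : ℕ) + 1)) : ℕ) : ℂ)).re
      = 1 - ∑ n : Fin N, (a n).re * ((min 2 (k / ((n : ℕ) + 1)) : ℕ) : ℝ) :=
    fun k => re_one_sub_sum_mul_natCast _ a _
  -- every generator is orthogonal to the certificate (sum extended down to k = 1)
  have hgen : ∀ n : Fin N,
      (∑ k ∈ Ico (1 : ℕ) L, 1 / ((k : ℝ) * (k + 1)) * r k * ((min 2 (k / ((n : ℕ) + 1)) : ℕ) : ℝ))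
        + rt * ((min 2 (L / ((n : ℕ) + 1)) : ℕ) : ℝ) / (L : ℝ) = 0 := by
    intro n
    have hj1 : 1 ≤ (n : ℕ) + 1 := by omega
    have hj2 : (n : ℕ) + 1 ≤ N := n.isLt
    have hjL : (n : ℕ) + 1 ≤ L := by omega
    have hmin : min 2 (L / ((n : ℕ) + 1)) = 2 :=
      min_eq_left ((Nat.le_div_iff_mul_le (by omega)).2 (by omega))
    rw [sum_Ico_one_eq_sum_Ico _ _ hj1 hjL, hmin, ← horth ((n : ℕ) + 1) hj1 hj2]
    push_cast
    ring
  -- the pairing ⟨C, r⟩ = ⟨1, r⟩ − Σ_n Re(a_n) ⟨g_n, r⟩ = v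
  have key : (∑ k ∈ Ico (1 : ℕ) L, 1 / ((k : ℝ) * (k + 1)) * r k *
        (1 - ∑ n : Fin N, a n * ((min 2 (k / ((n : ℕ) + 1)) : ℕ) : ℂ)).re)
      + 1 / (L : ℝ) * rt * (1 - ∑ n : Fin N, a n * ((min 2 (L / ((n : ℕ) + 1)) : ℕ) : ℂ)).re
      = v := by
    have e1 : ∀ k : ℕ, 1 / ((k : ℝ) * (k + 1)) * r k *
        (1 - ∑ n : Fin N, a n * ((min 2 (k / ((n : ℕ) + 1)) : ℕ) : ℂ)).re
        = 1 / ((k : ℝ) * (k + 1)) * r k - ∑ n : Fin N, (a n).re *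
          (1 / ((k : ℝ) * (k + 1)) * r k * ((min 2 (k / ((n : ℕ) + 1)) : ℕ) : ℝ)) := by
      intro k
      rw [hre, mul_sub, mul_one, Finset.mul_sum]
      congr 1
      exact Finset.sum_congr rfl fun n _ => by ring
    have e2 : 1 / (L : ℝ) * rt * (1 - ∑ n : Fin N, a n * ((min 2 (L / ((n : ℕ) + 1)) : ℕ) : ℂ)).re
        = rt / (L : ℝ) - ∑ n : Fin N, (a n).re *
          (rt * ((min 2 (L / ((n : ℕ) + 1)) : ℕ) : ℝ) / (L : ℝ)) := by
      rw [hre, mul_sub, mul_one, Finset.mul_sum]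
      congr 1
      · ring
      · exact Finset.sum_congr rfl fun n _ => by ring
    rw [Finset.sum_congr rfl fun k _ => e1 k, Finset.sum_sub_distrib, Finset.sum_comm, e2]
    simp_rw [← Finset.mul_sum]
    have hAB : (∑ n : Fin N, (a n).re * ∑ k ∈ Ico (1 : ℕ) L,
        1 / ((k : ℝ) * (k + 1)) * r k * ((min 2 (k / ((n : ℕ) + 1)) : ℕ) : ℝ))
        + ∑ n : Fin N, (a n).re * (rt * ((min 2 (L / ((n : ℕ) + 1)) : ℕ) : ℝ) / (L : ℝ)) = 0 := by
      rw [← Finset.sum_add_distrib]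
      exact Finset.sum_eq_zero fun n _ => by rw [← mul_add, hgen n, mul_zero]
    linear_combination hinner - hAB
  -- assemble
  have hV : (∑ k ∈ Ico (1 : ℕ) L,
        ‖1 - ∑ n : Fin N, a n * ((min 2 (k / ((n : ℕ) + 1)) : ℕ) : ℂ)‖ ^ 2 / ((k : ℝ) * (k + 1)))
      + ‖1 - ∑ n : Fin N, a n * ((min 2 (L / ((n : ℕ) + 1)) : ℕ) : ℂ)‖ ^ 2 / (L : ℝ)
      = (∑ k ∈ Ico (1 : ℕ) L, 1 / ((k : ℝ) * (k + 1)) *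
        ‖1 - ∑ n : Fin N, a n * ((min 2 (k / ((n : ℕ) + 1)) : ℕ) : ℂ)‖ ^ 2)
      + 1 / (L : ℝ) * ‖1 - ∑ n : Fin N, a n * ((min 2 (L / ((n : ℕ) + 1)) : ℕ) : ℂ)‖ ^ 2 := by
    congr 1
    · exact Finset.sum_congr rfl fun k _ => by ring
    · ring
  linear_combination hV + hblocks + htail + 2 * key - hnorm

/-! ## 3. Attainment -/

/-- Pairing the dyadic vector `a*_n = Σ_i [n+1 = 2^i] α_i` with a pattern `g`:
`Σ_n a*_n g(n+1) = Σ_{i ≤ K} α_i g(2^i)`. -/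
theorem sum_dyadicVector_mul (K : ℕ) (α : ℕ → ℝ) (g : ℕ → ℕ) :
    ∑ n : Fin (2 ^ K), (∑ i ∈ Finset.range (K + 1),
        if (n : ℕ) + 1 = 2 ^ i then ((α i : ℝ) : ℂ) else 0) * ((g ((n : ℕ) + 1) : ℕ) : ℂ)
      = ∑ i ∈ Finset.range (K + 1), ((α i : ℝ) : ℂ) * ((g (2 ^ i) : ℕ) : ℂ) := by
  simp_rw [Finset.sum_mul]
  rw [Finset.sum_comm]
  refine Finset.sum_congr rfl fun i hi => ?_
  rw [Finset.mem_range] at hi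
  have h1 : 1 ≤ 2 ^ i := Nat.one_le_two_pow
  have h2 : 2 ^ i ≤ 2 ^ K := Nat.pow_le_pow_right (by norm_num) (by omega)
  have hiK : 2 ^ i - 1 < 2 ^ K := by omega
  have h3 : 2 ^ i - 1 + 1 = 2 ^ i := by omega
  rw [Finset.sum_eq_single ⟨2 ^ i - 1, hiK⟩]
  · simp only [h3, if_true]
  · intro n _ hn
    have : ¬ ((n : ℕ) + 1 = 2 ^ i) := by
      intro h
      apply hn
      ext
      change (n : ℕ) = 2 ^ i - 1
      omega
    rw [if_neg this, zero_mul]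
  · intro h
    exact absurd (Finset.mem_univ _) h

/-- **Attainment**: if a real vector `α` supported on the dyadic generators has block partial sums
`r_k` (`1 ≤ k < 2^(K+1)`) and tail `r_tail`, then the step form of the corresponding mollifier is
`‖r‖² = Σ r_k²/(k(k+1)) + r_tail²/2^(K+1)`. [folklore] -/
theorem stepForm_attained (K : ℕ) (α r : ℕ → ℝ) (rt v : ℝ)
    (hres : ∀ k : ℕ, 1 ≤ k → k < 2 ^ (K + 1) →
      1 - ∑ i ∈ Finset.range (K + 1), α i * ((min 2 (k / 2 ^ i) : ℕ) : ℝ) = r k)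
    (htail : 1 - 2 * ∑ i ∈ Finset.range (K + 1), α i = rt)
    (hnorm : (∑ k ∈ Finset.Ico (1 : ℕ) (2 ^ (K + 1)), 1 / ((k : ℝ) * (k + 1)) * r k ^ 2)
      + rt ^ 2 / (2 : ℝ) ^ (K + 1) = v)
    (a : Fin (2 ^ K) → ℂ)
    (ha : ∀ n : Fin (2 ^ K), a n = ∑ i ∈ Finset.range (K + 1),
      if (n : ℕ) + 1 = 2 ^ i then ((α i : ℝ) : ℂ) else 0) :
    (∑ k ∈ Ico (1 : ℕ) (2 ^ (K + 1)),
        ‖1 - ∑ n : Fin (2 ^ K), a n * ((min 2 (k / ((n : ℕ) + 1)) : ℕ) : ℂ)‖ ^ 2 / ((k : ℝ) * (k + 1)))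
      + ‖1 - ∑ n : Fin (2 ^ K), a n * ((min 2 (2 ^ (K + 1) / ((n : ℕ) + 1)) : ℕ) : ℂ)‖ ^ 2
        / ((2 ^ (K + 1) : ℕ) : ℝ)
    = v := by
  simp_rw [ha]
  have hblock : ∀ k ∈ Ico (1 : ℕ) (2 ^ (K + 1)),
      (1 : ℂ) - ∑ n : Fin (2 ^ K), (∑ i ∈ Finset.range (K + 1),
          if (n : ℕ) + 1 = 2 ^ i then ((α i : ℝ) : ℂ) else 0) * ((min 2 (k / ((n : ℕ) + 1)) : ℕ) : ℂ)
        = ((r k : ℝ) : ℂ) := by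
    intro k hk
    rw [Finset.mem_Ico] at hk
    rw [sum_dyadicVector_mul K α (fun j => min 2 (k / j)), ← hres k hk.1 hk.2,
      Complex.ofReal_sub, Complex.ofReal_one, Complex.ofReal_sum]
    congr 1
    exact Finset.sum_congr rfl fun i _ => by rw [Complex.ofReal_mul, Complex.ofReal_natCast]
  have htail' : (1 : ℂ) - ∑ n : Fin (2 ^ K), (∑ i ∈ Finset.range (K + 1),
          if (n : ℕ) + 1 = 2 ^ i then ((α i : ℝ) : ℂ) else 0) *
        ((min 2 (2 ^ (K + 1) / ((n : ℕ) + 1)) : ℕ) : ℂ) = ((rt : ℝ) : ℂ) := by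
    rw [← htail, sum_dyadicVector_mul K α (fun j => min 2 (2 ^ (K + 1) / j)), Finset.mul_sum]
    push_cast
    congr 1
    refine Finset.sum_congr rfl fun i hi => ?_
    rw [Finset.mem_range] at hi
    have hmin : min 2 (2 ^ (K + 1) / 2 ^ i) = 2 := by
      apply min_eq_left
      rw [Nat.pow_div (by omega) (by norm_num)]
      calc (2 : ℕ) = 2 ^ 1 := (pow_one 2).symm
        _ ≤ 2 ^ (K + 1 - i) := Nat.pow_le_pow_right (by norm_num) (by omega)
    rw [hmin]
    push_cast
    ring
  have hsum : ∑ k ∈ Ico (1 : ℕ) (2 ^ (K + 1)),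
      ‖(1 : ℂ) - ∑ n : Fin (2 ^ K), (∑ i ∈ Finset.range (K + 1),
          if (n : ℕ) + 1 = 2 ^ i then ((α i : ℝ) : ℂ) else 0) * ((min 2 (k / ((n : ℕ) + 1)) : ℕ) : ℂ)‖ ^ 2
        / ((k : ℝ) * (k + 1))
      = ∑ k ∈ Ico (1 : ℕ) (2 ^ (K + 1)), 1 / ((k : ℝ) * (k + 1)) * r k ^ 2 := by
    refine Finset.sum_congr rfl fun k hk => ?_
    rw [hblock k hk, Complex.norm_real, Real.norm_eq_abs, sq_abs]
    ring
  rw [hsum, htail', Complex.norm_real, Real.norm_eq_abs, sq_abs, ← hnorm]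
  push_cast
  ring

end Summit.RiemannHypothesis.RiemannHypothesis.Theorems.NbSectionTwo

end
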